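import Mathlib.Data.Matrix.Basic
import Mathlib.Data.Real.Basic
import Mathlib.Tactic.Abel

/-!
# `BalabanUV.Beta.FP.GradedFormParity` — road «FP» for binder row D1, ROUTE T, option (δ) «LIFT ∕ GRADED» (R-FP-54′): **THE PARITY SLOTS OF THE
# GRADED ONE-SHOT STEP LAW ARE CLOSED UNDER THE GRADED NAMINGS** — `𝔎₀ᵀ = 𝔎₀`, `𝔎₁ᵀ = −𝔎₁`, `𝔎₂ᵀ = 𝔎₂` follow from the parities of the
# form tables `H₀ H₁ H₂` and of the constraint-metric tables `G₀ G₁ G₂` alone (an3 g97 W-1 (G3), suggestion S1)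

WHAT.  The graded door `FP/NestedStepLawOneShotJetsGraded.secondVar_oneShot_nestedStepLaw_jets_graded` (OWNER d1-p3 g18, INTENT I-FP-18-9 (9b))
takes the composite form jets through the GRADED namings
* `h𝔎₀ : H₀ + Q₁₀ᵀ * G₀ * Q₁₀ = 𝔎₀`,
* `h𝔎₁ : H₁ + (-(Q₁₁ᵀ * G₀ * Q₁₀) + Q₁₀ᵀ * G₁ * Q₁₀ + Q₁₀ᵀ * G₀ * Q₁₁) = 𝔎₁`,
* `h𝔎₂ : H₂ + ((Q₁₂ᵀ * G₀ * Q₁₀ + -(Q₁₁ᵀ * G₁ * Q₁₀) + -(Q₁₁ᵀ * G₀ * Q₁₁)) + (-(Q₁₁ᵀ * G₁ * Q₁₀) + Q₁₀ᵀ * G₂ * Q₁₀ + Q₁₀ᵀ * G₁ * Q₁₁)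
            + (-(Q₁₁ᵀ * G₀ * Q₁₁) + Q₁₀ᵀ * G₁ * Q₁₁ + Q₁₀ᵀ * G₀ * Q₁₂)) = 𝔎₂`
(sign `(−1)^(number of transposed odd objects)` on each word) and asks for the parities `h𝔎₀t : 𝔎₀ᵀ = 𝔎₀`, `h𝔎₁t : 𝔎₁ᵀ = -𝔎₁`,
`h𝔎₂t : 𝔎₂ᵀ = 𝔎₂` as DISPLAYED hypotheses.  This file is the [folklore] transpose bookkeeping, stated ONCE so that every consumer discharges the
three parity slots by `exact` from table parities: `K0t_of_graded` (`H₀ᵀ = H₀`, `G₀ᵀ = G₀`), `K1t_of_graded` (`H₁ᵀ = −H₁`, `G₀ᵀ = G₀`,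
`G₁ᵀ = −G₁`), `K2t_of_graded` (`H₂ᵀ = H₂`, `G₀ᵀ = G₀`, `G₁ᵀ = −G₁`, `G₂ᵀ = G₂`) — hypotheses = the door's namings VERBATIM + the table parities,
conclusions = the door's parity slots VERBATIM; and the word-level forms `gradedK0_transpose ∕ gradedK1_transpose ∕ gradedK2_transpose`.
At level 0 the Wilson member of `H₁ᵀ = −H₁` is `FP/PeriodisedFormIndexWardDoubled.torus_H1_transpose` (leaf-05 g27, p322868); the rooted
field–field table's is an1's `symHessFFAt_antisymm`; `H₀ H₂` are Hessian coefficients (symmetric); the `G`-table parities are the dictionary's.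
Nothing of the dictionary is asserted here: which typed tables instantiate `Hₙ Gₙ Q₁ₙ` is the OWNER's ∕ an2's word.

HONEST DEPENDENCY (page 1, mandatory): continuum YM on T⁴ ⇐ BetaPertH ∧ nine spine estimates (0/9 proved); BetaPertH ⇐ (D1) ∧ (D4) ∧ CAP+tail;
G-an2-4 gates asym, D1 and NE2/3/4.  HONEST FRAMING (cell contract, verbatim): «discharging `BetaPertH` makes Bałaban's UV stability UNCONDITIONAL —
a real constructive-QFT result; it is NOT the continuum limit and NOT the Clay problem.»  ABSOLUTE RULE (cell charter, verbatim): «No internally-minted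
statement may enter as a cited fact. Every hypothesis is either kernel-proved in this package or a verbatim quotation of a PUBLISHED theorem with page
reference. The manuscript(s) under audit are NOT citable for their own disputed steps — they are the thing under adjudication; programme-internal
(2001/route/tribunal) claims are never citable.»  [folklore] matrix transpose algebra only; no `def`, no `def … : Prop`, nothing cited, 0 sorry;
0 estimates; 0∕4 row-D1 binders; NOT (T-ID), NOT SDF, NOT D1, NOT BetaPertH, NOT continuum, NOT Clay.  D1 formalisation swarm LEAF PROVER 05
(b2b-balaban-beta-d1-formalise-leaf-05 gen 28), 2026-08-22.  No existing file touched.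
-/

namespace Summit.QuantumFields.BalabanUV.Beta.FP.GradedFormParity

open Matrix

variable {ν μ : Type*} [Fintype μ]

/-! ## §1 Word-level parities of the graded composite form jets -/

/-- [folklore] order 0: `(H₀ + Q₁₀ᵀ G₀ Q₁₀)ᵀ = H₀ + Q₁₀ᵀ G₀ Q₁₀` for symmetric `H₀`, `G₀`. -/
theorem gradedK0_transpose (H₀ : Matrix ν ν ℝ) (Q₁₀ : Matrix μ ν ℝ) (G₀ : Matrix μ μ ℝ) (hH₀ : H₀ᵀ = H₀) (hG₀ : G₀ᵀ = G₀) :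
    (H₀ + Q₁₀ᵀ * G₀ * Q₁₀)ᵀ = H₀ + Q₁₀ᵀ * G₀ * Q₁₀ := by
  rw [transpose_add, hH₀, transpose_mul, transpose_mul, transpose_transpose, hG₀, Matrix.mul_assoc]

/-- [folklore] order 1 (GRADED word, sign `−` on the one word led by a transposed odd object): the graded composite first form jet is
ANTISYMMETRIC when `H₁` and `G₁` are antisymmetric and `G₀` is symmetric. -/
theorem gradedK1_transpose (H₁ : Matrix ν ν ℝ) (Q₁₀ Q₁₁ : Matrix μ ν ℝ) (G₀ G₁ : Matrix μ μ ℝ)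
    (hH₁ : H₁ᵀ = -H₁) (hG₀ : G₀ᵀ = G₀) (hG₁ : G₁ᵀ = -G₁) :
    (H₁ + (-(Q₁₁ᵀ * G₀ * Q₁₀) + Q₁₀ᵀ * G₁ * Q₁₀ + Q₁₀ᵀ * G₀ * Q₁₁))ᵀ
      = -(H₁ + (-(Q₁₁ᵀ * G₀ * Q₁₀) + Q₁₀ᵀ * G₁ * Q₁₀ + Q₁₀ᵀ * G₀ * Q₁₁)) := by
  simp only [transpose_add, transpose_neg, transpose_mul, transpose_transpose, hH₁, hG₀, hG₁, Matrix.mul_assoc, Matrix.neg_mul,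
    Matrix.mul_neg, neg_add_rev, neg_neg]
  abel

/-- [folklore] order 2 (GRADED nine-word sum AS SPELLED in the door's `h𝔎₂`, the four words led by `Q₁₁ᵀ` negative): the graded composite
second form jet is SYMMETRIC when `H₂`, `G₀`, `G₂` are symmetric and `G₁` is antisymmetric. -/
theorem gradedK2_transpose (H₂ : Matrix ν ν ℝ) (Q₁₀ Q₁₁ Q₁₂ : Matrix μ ν ℝ) (G₀ G₁ G₂ : Matrix μ μ ℝ)
    (hH₂ : H₂ᵀ = H₂) (hG₀ : G₀ᵀ = G₀) (hG₁ : G₁ᵀ = -G₁) (hG₂ : G₂ᵀ = G₂) :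
    (H₂ + ((Q₁₂ᵀ * G₀ * Q₁₀ + -(Q₁₁ᵀ * G₁ * Q₁₀) + -(Q₁₁ᵀ * G₀ * Q₁₁)) + (-(Q₁₁ᵀ * G₁ * Q₁₀) + Q₁₀ᵀ * G₂ * Q₁₀ + Q₁₀ᵀ * G₁ * Q₁₁)
        + (-(Q₁₁ᵀ * G₀ * Q₁₁) + Q₁₀ᵀ * G₁ * Q₁₁ + Q₁₀ᵀ * G₀ * Q₁₂)))ᵀ
      = H₂ + ((Q₁₂ᵀ * G₀ * Q₁₀ + -(Q₁₁ᵀ * G₁ * Q₁₀) + -(Q₁₁ᵀ * G₀ * Q₁₁)) + (-(Q₁₁ᵀ * G₁ * Q₁₀) + Q₁₀ᵀ * G₂ * Q₁₀ + Q₁₀ᵀ * G₁ * Q₁₁)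
        + (-(Q₁₁ᵀ * G₀ * Q₁₁) + Q₁₀ᵀ * G₁ * Q₁₁ + Q₁₀ᵀ * G₀ * Q₁₂)) := by
  simp only [transpose_add, transpose_neg, transpose_mul, transpose_transpose, hH₂, hG₀, hG₁, hG₂, Matrix.mul_assoc, Matrix.neg_mul,
    Matrix.mul_neg, neg_neg]
  abel

/-! ## §2 The door's parity slots from its namings and the table parities -/

/-- [folklore] **`h𝔎₀t` FROM THE NAMING**: `h𝔎₀ : H₀ + Q₁₀ᵀ G₀ Q₁₀ = 𝔎₀`, `H₀ᵀ = H₀`, `G₀ᵀ = G₀` ⊢ `𝔎₀ᵀ = 𝔎₀`. -/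
theorem K0t_of_graded {H₀ 𝔎₀ : Matrix ν ν ℝ} {Q₁₀ : Matrix μ ν ℝ} {G₀ : Matrix μ μ ℝ} (h𝔎₀ : H₀ + Q₁₀ᵀ * G₀ * Q₁₀ = 𝔎₀)
    (hH₀ : H₀ᵀ = H₀) (hG₀ : G₀ᵀ = G₀) : 𝔎₀ᵀ = 𝔎₀ := by
  rw [← h𝔎₀]; exact gradedK0_transpose H₀ Q₁₀ G₀ hH₀ hG₀

/-- [folklore] **`h𝔎₁t` FROM THE GRADED NAMING**: `h𝔎₁` (VERBATIM), `H₁ᵀ = −H₁`, `G₀ᵀ = G₀`, `G₁ᵀ = −G₁` ⊢ `𝔎₁ᵀ = −𝔎₁`.  At level 0 the Wilson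
member of `H₁ᵀ = −H₁` is `PeriodisedFormIndexWardDoubled.torus_H1_transpose`. -/
theorem K1t_of_graded {H₁ 𝔎₁ : Matrix ν ν ℝ} {Q₁₀ Q₁₁ : Matrix μ ν ℝ} {G₀ G₁ : Matrix μ μ ℝ}
    (h𝔎₁ : H₁ + (-(Q₁₁ᵀ * G₀ * Q₁₀) + Q₁₀ᵀ * G₁ * Q₁₀ + Q₁₀ᵀ * G₀ * Q₁₁) = 𝔎₁)
    (hH₁ : H₁ᵀ = -H₁) (hG₀ : G₀ᵀ = G₀) (hG₁ : G₁ᵀ = -G₁) : 𝔎₁ᵀ = -𝔎₁ := by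
  rw [← h𝔎₁]; exact gradedK1_transpose H₁ Q₁₀ Q₁₁ G₀ G₁ hH₁ hG₀ hG₁

/-- [folklore] **`h𝔎₂t` FROM THE GRADED NAMING**: `h𝔎₂` (VERBATIM nine-word sum), `H₂ᵀ = H₂`, `G₀ᵀ = G₀`, `G₁ᵀ = −G₁`, `G₂ᵀ = G₂` ⊢ `𝔎₂ᵀ = 𝔎₂`. -/
theorem K2t_of_graded {H₂ 𝔎₂ : Matrix ν ν ℝ} {Q₁₀ Q₁₁ Q₁₂ : Matrix μ ν ℝ} {G₀ G₁ G₂ : Matrix μ μ ℝ}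
    (h𝔎₂ : H₂ + ((Q₁₂ᵀ * G₀ * Q₁₀ + -(Q₁₁ᵀ * G₁ * Q₁₀) + -(Q₁₁ᵀ * G₀ * Q₁₁)) + (-(Q₁₁ᵀ * G₁ * Q₁₀) + Q₁₀ᵀ * G₂ * Q₁₀ + Q₁₀ᵀ * G₁ * Q₁₁)
        + (-(Q₁₁ᵀ * G₀ * Q₁₁) + Q₁₀ᵀ * G₁ * Q₁₁ + Q₁₀ᵀ * G₀ * Q₁₂)) = 𝔎₂)
    (hH₂ : H₂ᵀ = H₂) (hG₀ : G₀ᵀ = G₀) (hG₁ : G₁ᵀ = -G₁) (hG₂ : G₂ᵀ = G₂) : 𝔎₂ᵀ = 𝔎₂ := by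
  rw [← h𝔎₂]; exact gradedK2_transpose H₂ Q₁₀ Q₁₁ Q₁₂ G₀ G₁ G₂ hH₂ hG₀ hG₁ hG₂

/-! ## §3 The constraint-side gradings carry no parity condition; the flat-metric instance -/

/-- [folklore] **FLAT CONSTRAINT METRIC**: if the constraint-metric jet is static (`G₁ = 0`, `G₂ = 0`; e.g. a constant averaging weight
`G₀ = a • 1`), the three parity slots reduce to `H₀ᵀ = H₀`, `H₁ᵀ = −H₁`, `H₂ᵀ = H₂` and `G₀ᵀ = G₀` — order 1. -/
theorem K1t_of_graded_static {H₁ 𝔎₁ : Matrix ν ν ℝ} {Q₁₀ Q₁₁ : Matrix μ ν ℝ} {G₀ : Matrix μ μ ℝ}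
    (h𝔎₁ : H₁ + (-(Q₁₁ᵀ * G₀ * Q₁₀) + Q₁₀ᵀ * (0 : Matrix μ μ ℝ) * Q₁₀ + Q₁₀ᵀ * G₀ * Q₁₁) = 𝔎₁)
    (hH₁ : H₁ᵀ = -H₁) (hG₀ : G₀ᵀ = G₀) : 𝔎₁ᵀ = -𝔎₁ :=
  K1t_of_graded h𝔎₁ hH₁ hG₀ (by rw [transpose_zero, neg_zero])

/-- [folklore] flat constraint metric — order 2. -/
theorem K2t_of_graded_static {H₂ 𝔎₂ : Matrix ν ν ℝ} {Q₁₀ Q₁₁ Q₁₂ : Matrix μ ν ℝ} {G₀ : Matrix μ μ ℝ}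
    (h𝔎₂ : H₂ + ((Q₁₂ᵀ * G₀ * Q₁₀ + -(Q₁₁ᵀ * (0 : Matrix μ μ ℝ) * Q₁₀) + -(Q₁₁ᵀ * G₀ * Q₁₁))
        + (-(Q₁₁ᵀ * (0 : Matrix μ μ ℝ) * Q₁₀) + Q₁₀ᵀ * (0 : Matrix μ μ ℝ) * Q₁₀ + Q₁₀ᵀ * (0 : Matrix μ μ ℝ) * Q₁₁)
        + (-(Q₁₁ᵀ * G₀ * Q₁₁) + Q₁₀ᵀ * (0 : Matrix μ μ ℝ) * Q₁₁ + Q₁₀ᵀ * G₀ * Q₁₂)) = 𝔎₂)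
    (hH₂ : H₂ᵀ = H₂) (hG₀ : G₀ᵀ = G₀) : 𝔎₂ᵀ = 𝔎₂ :=
  K2t_of_graded h𝔎₂ hH₂ hG₀ (by rw [transpose_zero, neg_zero]) transpose_zero

end Summit.QuantumFields.BalabanUV.Beta.FP.GradedFormParity
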